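import Mathlib.Analysis.SpecialFunctions.Pow.Real
import Mathlib.Analysis.SpecialFunctions.Log.Basic
import HarnessLib

/-!
# Short intervals for cosets of a congruence class group, III: a real inequality absorbing the imprimitive correction

Topic `Summits/QuantumAdvantage/QuantumAdvantage/Theorems`, cell B2b-1 (linnik-cubic), PART A (gen 23); helper toward
the crux `DegreeOnePrimesEscape` (stmt-QuantumAdvantage-11543) of route `LinnikCubicClassGroups`.  HONEST FRAMING: the
value of this file is a THEOREM (kernel-checked real-variable bookkeeping) — NOT summit progress.

`imprimitive_junk_le`: the cost `|G| · 2(L + η + 2) · log N𝔪` of passing from the imprimitive coefficients `Λ^𝔪_ψ` to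
the primitive ones in the window explicit formula (`…RayClassWindowSmoothed`) is at most `(κ c₁/4) Q^{−2} x η` once
`|G| ≤ Q⁴`, `0 ≤ log N𝔪 ≤ Q − 1`, `x^{−θ/8} ≤ 2η` (`0 < θ ≤ 1/8`, `0 < η ≤ 1`) and the threshold inequality
`(64/(κ c₁)) Q⁷ (L + 1) x^{−1/4} ≤ 1` (`absorb_junk`) hold.
-/

namespace Summit.QuantumAdvantage.QuantumAdvantage.Theorems.DegreeOnePrimesEscape

/-- **Absorption of the imprimitive correction** (see the module docstring). -/
theorem imprimitive_junk_le {G Q x η θ κ c₁ m : ℝ} (hQ : 12 ≤ Q) (hG : G ≤ Q ^ (4 : ℕ))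
    (hm0 : 0 ≤ m) (hm : m ≤ Q - 1) (hx : 1 ≤ x) (hη0 : 0 < η) (hη1 : η ≤ 1)
    (hθ : 0 < θ) (hθ1 : θ ≤ 1 / 8) (hηx : Real.exp (-(θ / 8) * Real.log x) ≤ 2 * η) (hκ : 0 < κ) (hc₁ : 0 < c₁)
    (habs : 64 / (κ * c₁) * Q ^ (7 : ℕ) * (Real.log x + 1) * x ^ (-((1 : ℝ) / 4)) ≤ 1) :
    G * (2 * (Real.log x + η + 2) * m) ≤ κ * c₁ / 4 * Q ^ (-(2 : ℝ)) * x * η := by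
  have hQ0 : 0 < Q := by linarith
  have hx0 : 0 < x := by linarith
  set L : ℝ := Real.log x with hL
  have hL0 : 0 ≤ L := Real.log_nonneg hx
  have hκc : 0 < κ * c₁ := mul_pos hκ hc₁
  -- `x^{3/4} ≤ 2 x η`
  have hxη : x ^ ((3 : ℝ) / 4) ≤ 2 * (x * η) := by
    have h1 : x ^ ((3 : ℝ) / 4) ≤ x ^ (1 - θ / 8) :=
      Real.rpow_le_rpow_of_exponent_le hx (by linarith)
    have h2 : x ^ (1 - θ / 8) = x * Real.exp (-(θ / 8) * Real.log x) := by
      rw [Real.rpow_def_of_pos hx0, ← hL]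
      conv_rhs => rw [show x = Real.exp L by rw [hL, Real.exp_log hx0], ← Real.exp_add]
      ring_nf
    have h3 : x * Real.exp (-(θ / 8) * Real.log x) ≤ x * (2 * η) := mul_le_mul_of_nonneg_left hηx hx0.le
    linarith
  -- `64 Q⁷ (L+1) ≤ κ c₁ x^{3/4}`
  have hx14 : 0 < x ^ (-((1 : ℝ) / 4)) := Real.rpow_pos_of_pos hx0 _
  have hx34 : 0 < x ^ ((3 : ℝ) / 4) := Real.rpow_pos_of_pos hx0 _
  have hmain : 64 * Q ^ (7 : ℕ) * (L + 1) ≤ κ * c₁ * x ^ ((3 : ℝ) / 4) := by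
    -- from `habs`: `64 Q⁷ (L+1) x^{-1/4} ≤ κ c₁`, and `x^{-3/4} ≤ x^{-1/4}`
    have h1 : 64 * Q ^ (7 : ℕ) * (L + 1) * x ^ (-((1 : ℝ) / 4)) ≤ κ * c₁ := by
      have := mul_le_mul_of_nonneg_left habs hκc.le
      have e : κ * c₁ * (64 / (κ * c₁) * Q ^ (7 : ℕ) * (Real.log x + 1) * x ^ (-((1 : ℝ) / 4))) =
          64 * Q ^ (7 : ℕ) * (L + 1) * x ^ (-((1 : ℝ) / 4)) := by
        rw [hL]; field_simp
      linarith
    have h2 : x ^ (-((3 : ℝ) / 4)) ≤ x ^ (-((1 : ℝ) / 4)) := Real.rpow_le_rpow_of_exponent_le hx (by norm_num)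
    have h3 : 64 * Q ^ (7 : ℕ) * (L + 1) * x ^ (-((3 : ℝ) / 4)) ≤ κ * c₁ :=
      (mul_le_mul_of_nonneg_left h2 (by positivity)).trans h1
    have h4 : x ^ (-((3 : ℝ) / 4)) * x ^ ((3 : ℝ) / 4) = 1 := by
      rw [← Real.rpow_add hx0]; norm_num
    have h5 := mul_le_mul_of_nonneg_right h3 hx34.le
    calc 64 * Q ^ (7 : ℕ) * (L + 1) = 64 * Q ^ (7 : ℕ) * (L + 1) * (x ^ (-((3 : ℝ) / 4)) * x ^ ((3 : ℝ) / 4)) := by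
          rw [h4, mul_one]
      _ = 64 * Q ^ (7 : ℕ) * (L + 1) * x ^ (-((3 : ℝ) / 4)) * x ^ ((3 : ℝ) / 4) := by ring
      _ ≤ κ * c₁ * x ^ ((3 : ℝ) / 4) := h5
  -- the left side: `G · 2(L+η+2) m ≤ Q⁴ · 8(L+1) · Q = 8 Q⁵ (L+1)`
  have hlhs : G * (2 * (L + η + 2) * m) ≤ 8 * Q ^ (5 : ℕ) * (L + 1) := by
    have h1 : 2 * (L + η + 2) * m ≤ 8 * (L + 1) * Q := by
      have : 2 * (L + η + 2) ≤ 8 * (L + 1) := by linarith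
      exact mul_le_mul this (by linarith) hm0 (by positivity)
    calc G * (2 * (L + η + 2) * m) ≤ Q ^ (4 : ℕ) * (8 * (L + 1) * Q) :=
          mul_le_mul hG h1 (by positivity) (by positivity)
      _ = 8 * Q ^ (5 : ℕ) * (L + 1) := by ring
  -- `Q^{-2} · Q⁷ = Q⁵`
  have hQ2 : Q ^ (-(2 : ℝ)) * Q ^ (7 : ℕ) = Q ^ (5 : ℕ) := by
    rw [show (Q ^ (7 : ℕ) : ℝ) = Q ^ (7 : ℝ) by exact_mod_cast (Real.rpow_natCast Q 7).symm,
      show (Q ^ (5 : ℕ) : ℝ) = Q ^ (5 : ℝ) by exact_mod_cast (Real.rpow_natCast Q 5).symm, ← Real.rpow_add hQ0]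
    norm_num
  have hQm2 : 0 < Q ^ (-(2 : ℝ)) := Real.rpow_pos_of_pos hQ0 _
  refine hlhs.trans ?_
  -- `8 Q⁵ (L+1) = (1/8) Q^{-2} (64 Q⁷ (L+1)) ≤ (1/8) Q^{-2} κ c₁ x^{3/4} ≤ (κc₁/4) Q^{-2} x η`
  have h1 : 8 * Q ^ (5 : ℕ) * (L + 1) = (1 / 8) * Q ^ (-(2 : ℝ)) * (64 * Q ^ (7 : ℕ) * (L + 1)) := by
    rw [← hQ2]; ring
  rw [h1]
  have h2 : (1 / 8) * Q ^ (-(2 : ℝ)) * (64 * Q ^ (7 : ℕ) * (L + 1)) ≤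
      (1 / 8) * Q ^ (-(2 : ℝ)) * (κ * c₁ * x ^ ((3 : ℝ) / 4)) :=
    mul_le_mul_of_nonneg_left hmain (by positivity)
  have h3 : (1 / 8) * Q ^ (-(2 : ℝ)) * (κ * c₁ * x ^ ((3 : ℝ) / 4)) ≤
      (1 / 8) * Q ^ (-(2 : ℝ)) * (κ * c₁ * (2 * (x * η))) :=
    mul_le_mul_of_nonneg_left (mul_le_mul_of_nonneg_left hxη hκc.le) (by positivity)
  have e : (1 / 8) * Q ^ (-(2 : ℝ)) * (κ * c₁ * (2 * (x * η))) = κ * c₁ / 4 * Q ^ (-(2 : ℝ)) * x * η := by ring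
  linarith

end Summit.QuantumAdvantage.QuantumAdvantage.Theorems.DegreeOnePrimesEscape
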